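import Summits.QuantumFields.YangMills.Theorems.BalabanUVNodesN19JointLawPriceDimension

/-!
# YM-DAG node N19 (= NE7 proper) — THE DIMENSION DEPENDENCE OF THE JOINT-LAW PRICE, LOWER HALF: the product binomial witness (all mixed moments
# `2^{−n}`-close, an additive `1`-Lipschitz functional `|ι|∕(πn)` apart) and the TWO-SIDED statement

Cell `pub-ymgap`, HUMAN RULING D-0062 (Track A) ∕ D-0149 (work-bound push), R141 (C) wider-strategy seat `pub-ymgap-dag-n19-e` (strategy s3 =
ALTERNATIVE CURRENCY), generation g21, module 3 (lineage module 66; sibling of module 65 `…N19JointLawPriceDimension`, split under the 400-line rule).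
Route `Summits/QuantumFields/YangMills/Theses/BalabanUVNodes.lean` rev 25, cluster item K3⁷ «SpineGivenEndpointR13SepCoPH» (stmt-QuantumFields-20544);
filed `--supports` that item `--as helper` (it proves no registered stub).  COUNT-NEUTRAL: [folklore] probability over Mathlib + the lineage BY NAME —
module 65 (`law_price_le_of_uniformMixedMoments`, `law_price_additive_le_card`), p543481 `…N19LawPrice` (`exists_binomial_witness`, `cosWave_grid`,
`lipschitzWith_one_cosWave`, `cosWave_nonneg`, `cosWave_le`) and p510514 `…N19NoLinearPrice` (`integral_sum_smul_dirac`, `sum_smul_dirac_apply_of_mem`);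
no scheme object, no Theses import; NOT a discharge claim.

THE RESULT (`d = |ι| ≥ 1`).  §3 THE PRODUCT BINOMIAL WITNESS ★★ `exists_uniformMixedMoments_close_laws_far`: `P = ν_n^{⊗ι}`, `Q = μ_n^{⊗ι}` with
`(μ_n, ν_n)` module 63's binomial pair REBUILT ON `[0, ½]` (`exists_halfInterval_witness`: p543481's signed binomial weights at the atoms `k∕(2n)`,
`k ≤ n`, through `exists_lawPair_of_weights_at` = p510514's two-laws device at prescribed atoms, so that each law's `j`-th moment lies in `[0, 2^{−j}]` and
the moments `j < n` AGREE).  A mixed moment `∏_i m_{j_i}` differs between `P` and `Q` only through `S = {i : j_i ≥ n}`; when `S ≠ ∅` both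
`∏_{i∈S} m_{j_i}` lie in `[0, 2^{−n}]` and the common factor `∏_{i∉S} m_{j_i} ∈ [0,1]` comes out (`abs_prod_sub_prod_le_of_agree`, `prod_le_half_pow_of_le`):
ALL mixed moments are `2^{−n}`-close — NO `d` in the closeness — while the additive, `1`-ℓ¹-Lipschitz, `[0, d∕(πn)]`-valued `Σ_i (1 − cos 2πnx_i)∕(2πn)`
is paid EXACTLY `d∕(πn)` (`measurePreserving_eval`; the `|ι| = 1` payment `1∕(πn)` per coordinate, `integral_fintype_prod_eq_prod` for the moments).
§4 ★★ `jointLaw_price_dimension_two_sided`: (i) general upper `(76Kd² + 12Gd)∕(1 + log r⁻¹)` (module 65); (ii) additive upper `48d(K+G)∕(1 + log r⁻¹)`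
(module 65); (iii) LOWER: for every `0 < r₀ ≤ 1` and every finite nonempty `ι`, laws `P, Q` on `[0,1]^ι` with all mixed moments within some
`0 < r ≤ r₀` and a `1`-Lipschitz `g : ℝ → [0,1]` whose additive functional `Σ_i g(x_i)` is paid `≥ (d∕6)∕(1 + log r⁻¹)` (§3 at `r = 2^{−n}`).
SO: on the ADDITIVE class (sums of one-string observables — the observables of modules 53 ∕ 54) the law-level price of uniform mixed-moment closeness
is EXACTLY LINEAR in the number of strings, `Θ(d∕(1 + log r⁻¹))` two-sided; on the general ℓ¹-Lipschitz class it lies between `d` and `d²` — an HONEST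
GAP, not closed here: the product witness sees no more than the marginals do (a `d²` lower bound would need non-product pairs; a `d` upper bound an
approximant with sub-tensor `ℓ¹` mass).

HONEST FRAMING (binding).  Elementary and [folklore] (signed binomial measures; tensorisation); NO consumer in the DAG today (an optimality statement about
the seat's own currency); nothing of Bałaban's instantiated; NE7 NOT PRINTED, NOT proved; N19 NOT discharged; count-neutral.  One finite `T⁴` programme
at fixed `ε`; nothing continuum ∕ `ℝ⁴` ∕ OS ∕ mass-gap ∕ Clay.  0 `def` ∕ 0 `sorry`.
-/

noncomputable section

open Real Finset MeasureTheory ProbabilityTheory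

namespace Summit.QuantumFields.YangMills.Theorems.BalabanUVNodesN19JointLawPriceDimensionWitness

open Summit.QuantumFields.YangMills.Theorems.BalabanUVNodesN19JointLawPriceDimension (law_price_le_of_uniformMixedMoments law_price_additive_le_card)
open Summit.QuantumFields.YangMills.Theorems.BalabanUVNodesN19LawPrice
  (exists_binomial_witness cosWave_grid lipschitzWith_one_cosWave cosWave_nonneg cosWave_le)
open Summit.QuantumFields.YangMills.Theorems.BalabanUVNodesN19NoLinearPrice (integral_sum_smul_dirac sum_smul_dirac_apply_of_mem)

variable {ι : Type*} [Fintype ι]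

/-! ## §3 The product binomial witness: all mixed moments `2^{−n}`-close (no `d`), an additive `1`-Lipschitz functional `d∕(πn)` apart [folklore] -/

/-- **Two probability laws from a signed weight vector, at prescribed atoms** (p510514's `exists_lawPair_of_weights` with general atoms `x_j` in a
measurable set `s`): `μ = Σ_j w_j⁻δ_{x_j}`, `ν = Σ_j w_j⁺δ_{x_j}`, `w^± = (|w| ± w)∕2`, both carried by `s`, with BOTH integral identities. [folklore] -/
theorem exists_lawPair_of_weights_at (w : ℕ → ℝ) (x : ℕ → ℝ) {D : ℕ}
    (h0 : ∑ j ∈ range D, w j = 0) (h2 : ∑ j ∈ range D, |w j| = 2) {s : Set ℝ} (hs : MeasurableSet s)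
    (hx : ∀ j ∈ range D, x j ∈ s) :
    ∃ μ ν : Measure ℝ, IsProbabilityMeasure μ ∧ IsProbabilityMeasure ν ∧ μ sᶜ = 0 ∧ ν sᶜ = 0 ∧
      (∀ g : ℝ → ℝ, ∫ y, g y ∂μ = ∑ j ∈ range D, (|w j| - w j) / 2 * g (x j)) ∧
      (∀ g : ℝ → ℝ, ∫ y, g y ∂ν = ∑ j ∈ range D, (|w j| + w j) / 2 * g (x j)) := by
  have hp0 : ∀ j, 0 ≤ (|w j| + w j) / 2 := fun j => by have := neg_abs_le (w j); linarith
  have hn0 : ∀ j, 0 ≤ (|w j| - w j) / 2 := fun j => by have := le_abs_self (w j); linarith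
  have hp1 : ∑ j ∈ range D, (|w j| + w j) / 2 = 1 := by rw [← sum_div, sum_add_distrib, h2, h0]; norm_num
  have hn1 : ∑ j ∈ range D, (|w j| - w j) / 2 = 1 := by rw [← sum_div, sum_sub_distrib, h2, h0]; norm_num
  set μ : Measure ℝ := ∑ j ∈ range D, ENNReal.ofReal ((|w j| - w j) / 2) • Measure.dirac (x j) with hμ
  set ν : Measure ℝ := ∑ j ∈ range D, ENNReal.ofReal ((|w j| + w j) / 2) • Measure.dirac (x j) with hν
  have iμ : IsProbabilityMeasure μ :=
    ⟨by rw [hμ, sum_smul_dirac_apply_of_mem _ hn0 _ fun j _ => Set.mem_univ _, hn1, ENNReal.ofReal_one]⟩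
  have iν : IsProbabilityMeasure ν :=
    ⟨by rw [hν, sum_smul_dirac_apply_of_mem _ hp0 _ fun j _ => Set.mem_univ _, hp1, ENNReal.ofReal_one]⟩
  refine ⟨μ, ν, iμ, iν, ?_, ?_, fun g => ?_, fun g => ?_⟩
  · rw [prob_compl_eq_zero_iff hs, hμ, sum_smul_dirac_apply_of_mem _ hn0 _ hx, hn1, ENNReal.ofReal_one]
  · rw [prob_compl_eq_zero_iff hs, hν, sum_smul_dirac_apply_of_mem _ hp0 _ hx, hp1, ENNReal.ofReal_one]
  · rw [hμ, integral_sum_smul_dirac _ hn0]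
  · rw [hν, integral_sum_smul_dirac _ hp0]

/-- **THE BINOMIAL PAIR ON `[0, ½]`** (module 63's `exists_uniformMoments_close_laws_far`, rebuilt with the support information): for `n ≥ 1` two
probability laws `μ, ν` on `[0, ½]` (p543481's signed binomial weights at the atoms `k∕(2n)`, `k ≤ n`) whose `j`-th moments lie in `[0, 2^{−j}]`, AGREE for
`j < n`, and which pay the test function `(1 − cos 2πnx)∕(2πn)` exactly `−(−1)^n∕(πn)`. [folklore] -/
theorem exists_halfInterval_witness {n : ℕ} (hn : 0 < n) :
    ∃ μ ν : Measure ℝ, IsProbabilityMeasure μ ∧ IsProbabilityMeasure ν ∧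
      μ (Set.Icc (0 : ℝ) (1 / 2))ᶜ = 0 ∧ ν (Set.Icc (0 : ℝ) (1 / 2))ᶜ = 0 ∧
      (∀ j : ℕ, 0 ≤ ∫ x, x ^ j ∂μ ∧ ∫ x, x ^ j ∂μ ≤ (1 / 2 : ℝ) ^ j) ∧
      (∀ j : ℕ, 0 ≤ ∫ x, x ^ j ∂ν ∧ ∫ x, x ^ j ∂ν ≤ (1 / 2 : ℝ) ^ j) ∧
      (∀ j : ℕ, j < n → ∫ x, x ^ j ∂ν = ∫ x, x ^ j ∂μ) ∧
      ∫ x, (1 - cos (π * (2 * n : ℕ) * x)) / (π * (2 * n : ℕ)) ∂ν - ∫ x, (1 - cos (π * (2 * n : ℕ) * x)) / (π * (2 * n : ℕ)) ∂μ =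
        -(-1 : ℝ) ^ n * (1 / (π * n)) := by
  obtain ⟨w, ε, -, h0, h2, -, -, -, -, hmom, htest⟩ := exists_binomial_witness one_pos hn
  have hnr : (0 : ℝ) < n := Nat.cast_pos.2 hn
  -- atoms `k∕(2n)`, `k ≤ n`, in `[0, ½]`
  have hx : ∀ k ∈ range (n + 1), (k : ℝ) / (2 * n : ℕ) ∈ Set.Icc (0 : ℝ) (1 / 2) := fun k hk => by
    have hkn : (k : ℝ) ≤ n := by exact_mod_cast Nat.lt_succ_iff.1 (Finset.mem_range.1 hk)
    refine ⟨by positivity, ?_⟩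
    rw [div_le_iff₀ (by positivity)]
    push_cast
    linarith
  obtain ⟨μ, ν, iμ, iν, hμ, hν, hgμ, hgν⟩ :=
    exists_lawPair_of_weights_at w (fun k => (k : ℝ) / (2 * n : ℕ)) h0 h2 measurableSet_Icc hx
  have hnode : ∀ k : ℕ, ((k : ℝ) / (2 * n : ℕ)) = (1 / 2) * ((k : ℝ) / n) := fun k => by push_cast; field_simp
  -- moments of either law lie in `[0, 2^{−j}]`
  have hmomlaw : ∀ (c : ℕ → ℝ), (∀ k, 0 ≤ c k) → ∑ k ∈ range (n + 1), c k = 1 → ∀ j : ℕ,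
      0 ≤ ∑ k ∈ range (n + 1), c k * ((k : ℝ) / (2 * n : ℕ)) ^ j ∧
        ∑ k ∈ range (n + 1), c k * ((k : ℝ) / (2 * n : ℕ)) ^ j ≤ (1 / 2 : ℝ) ^ j := by
    intro c hc hc1 j
    refine ⟨Finset.sum_nonneg fun k hk => mul_nonneg (hc k) (pow_nonneg (hx k hk).1 _), ?_⟩
    calc ∑ k ∈ range (n + 1), c k * ((k : ℝ) / (2 * n : ℕ)) ^ j ≤ ∑ k ∈ range (n + 1), c k * (1 / 2 : ℝ) ^ j :=
          Finset.sum_le_sum fun k hk => mul_le_mul_of_nonneg_left (pow_le_pow_left₀ (hx k hk).1 (hx k hk).2 j) (hc k)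
      _ = (1 / 2 : ℝ) ^ j := by rw [← Finset.sum_mul, hc1, one_mul]
  have hp1 : ∑ k ∈ range (n + 1), (|w k| + w k) / 2 = 1 := by rw [← sum_div, sum_add_distrib, h2, h0]; norm_num
  have hn1 : ∑ k ∈ range (n + 1), (|w k| - w k) / 2 = 1 := by rw [← sum_div, sum_sub_distrib, h2, h0]; norm_num
  have hdiff : ∀ g : ℝ → ℝ, ∫ y, g y ∂ν - ∫ y, g y ∂μ = ∑ k ∈ range (n + 1), w k * g ((k : ℝ) / (2 * n : ℕ)) := fun g => by
    rw [hgν, hgμ, ← Finset.sum_sub_distrib]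
    exact Finset.sum_congr rfl fun k _ => by ring
  refine ⟨μ, ν, iμ, iν, hμ, hν, fun j => ?_, fun j => ?_, fun j hj => ?_, ?_⟩
  · rw [hgμ]
    exact hmomlaw _ (fun k => by have := le_abs_self (w k); linarith) hn1 j
  · rw [hgν]
    exact hmomlaw _ (fun k => by have := neg_abs_le (w k); linarith) hp1 j
  · have h := hdiff fun y => y ^ j
    have e : ∑ k ∈ range (n + 1), w k * ((k : ℝ) / (2 * n : ℕ)) ^ j = (1 / 2 : ℝ) ^ j * ∑ k ∈ range (n + 1), w k * ((k : ℝ) / n) ^ j := by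
      rw [Finset.mul_sum]
      exact Finset.sum_congr rfl fun k _ => by rw [hnode, mul_pow]; ring
    rw [e, hmom j hj, mul_zero] at h
    linarith
  · have h2n : 0 < 2 * n := by omega
    rw [hdiff, Finset.sum_congr rfl fun k _ => by rw [cosWave_grid h2n k]]
    have e : ∀ k : ℕ, w k * ((1 - (-1 : ℝ) ^ k) / (π * (2 * n : ℕ))) = (1 / 2 : ℝ) * (w k * ((1 - (-1 : ℝ) ^ k) / (π * n))) := fun k => by
      push_cast
      field_simp
    simp_rw [e]
    rw [← Finset.mul_sum, htest]
    ring

/-- Two products over a finite type whose factors AGREE off a predicate `p` (`a_i = b_i` for `¬p i`), with `0 ≤ a_i ≤ 1` and `0 ≤ b_i`: splitting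
`∏ = ∏_{p} · ∏_{¬p}`, the common factor `∏_{¬p} a_i ∈ [0,1]` comes out and `|∏_i a_i − ∏_i b_i| ≤ max (∏_{p} a_i) (∏_{p} b_i)`. [bookkeeping] -/
theorem abs_prod_sub_prod_le_of_agree [DecidableEq ι] (p : ι → Prop) [DecidablePred p] {a b : ι → ℝ}
    (hab : ∀ i, ¬p i → a i = b i) (ha0 : ∀ i, 0 ≤ a i) (ha1 : ∀ i, a i ≤ 1) (hb0 : ∀ i, 0 ≤ b i) :
    |∏ i, a i - ∏ i, b i| ≤ max (∏ i ∈ Finset.univ.filter p, a i) (∏ i ∈ Finset.univ.filter p, b i) := by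
  have hsplit : ∀ c : ι → ℝ, ∏ i, c i = (∏ i ∈ Finset.univ.filter p, c i) * ∏ i ∈ Finset.univ.filter (fun i => ¬p i), c i :=
    fun c => (Finset.prod_filter_mul_prod_filter_not Finset.univ p c).symm
  have hoff : ∏ i ∈ Finset.univ.filter (fun i => ¬p i), a i = ∏ i ∈ Finset.univ.filter (fun i => ¬p i), b i :=
    Finset.prod_congr rfl fun i hi => hab i (Finset.mem_filter.1 hi).2
  have hC0 : 0 ≤ ∏ i ∈ Finset.univ.filter (fun i => ¬p i), a i := Finset.prod_nonneg fun i _ => ha0 i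
  have hC1 : ∏ i ∈ Finset.univ.filter (fun i => ¬p i), a i ≤ 1 := Finset.prod_le_one (fun i _ => ha0 i) fun i _ => ha1 i
  have hA0 : 0 ≤ ∏ i ∈ Finset.univ.filter p, a i := Finset.prod_nonneg fun i _ => ha0 i
  have hB0 : 0 ≤ ∏ i ∈ Finset.univ.filter p, b i := Finset.prod_nonneg fun i _ => hb0 i
  rw [hsplit a, hsplit b, ← hoff, ← sub_mul, abs_mul, abs_of_nonneg hC0]
  calc |∏ i ∈ Finset.univ.filter p, a i - ∏ i ∈ Finset.univ.filter p, b i| * ∏ i ∈ Finset.univ.filter (fun i => ¬p i), a i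
      ≤ |∏ i ∈ Finset.univ.filter p, a i - ∏ i ∈ Finset.univ.filter p, b i| * 1 :=
        mul_le_mul_of_nonneg_left hC1 (abs_nonneg _)
    _ ≤ max (∏ i ∈ Finset.univ.filter p, a i) (∏ i ∈ Finset.univ.filter p, b i) := by
        rw [mul_one, abs_sub_le_iff]
        constructor
        · linarith [le_max_left (∏ i ∈ Finset.univ.filter p, a i) (∏ i ∈ Finset.univ.filter p, b i)]
        · linarith [le_max_right (∏ i ∈ Finset.univ.filter p, a i) (∏ i ∈ Finset.univ.filter p, b i)]

omit [Fintype ι] in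
/-- A product of numbers in `[0, 2^{−j_i}]` over a nonempty index set on which `j_i ≥ n` is at most `2^{−n}`. [bookkeeping] -/
theorem prod_le_half_pow_of_le {s : Finset ι} (hs : s.Nonempty) {c : ι → ℝ} {j : ι → ℕ} {n : ℕ}
    (hc0 : ∀ i, 0 ≤ c i) (hc : ∀ i, c i ≤ (1 / 2 : ℝ) ^ j i) (hj : ∀ i ∈ s, n ≤ j i) :
    ∏ i ∈ s, c i ≤ (1 / 2 : ℝ) ^ n := by
  classical
  obtain ⟨i₀, hi₀⟩ := hs
  rw [← Finset.mul_prod_erase s c hi₀]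
  have h1 : ∏ i ∈ s.erase i₀, c i ≤ 1 :=
    Finset.prod_le_one (fun i _ => hc0 i) fun i _ => (hc i).trans (pow_le_one₀ (by norm_num) (by norm_num))
  calc c i₀ * ∏ i ∈ s.erase i₀, c i ≤ (1 / 2 : ℝ) ^ j i₀ * 1 := mul_le_mul (hc i₀) h1 (Finset.prod_nonneg fun i _ => hc0 i) (by positivity)
    _ ≤ (1 / 2 : ℝ) ^ n := by rw [mul_one]; exact pow_le_pow_of_le_one (by norm_num) (by norm_num) (hj i₀ hi₀)

/-- **★★ THE PRODUCT BINOMIAL WITNESS: ALL MIXED MOMENTS `2^{−n}`-CLOSE, AN ADDITIVE `1`-LIPSCHITZ FUNCTIONAL `d∕(πn)` APART.**  For every finite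
nonempty `ι` (`d = |ι|`) and `n ≥ 1`: the product laws `P = μ_n^{⊗ι}`, `Q = ν_n^{⊗ι}` of the binomial pair on `[0, ½]` are probability laws on `[0,1]^ι`
with `|∫∏x_i^{j_i} dP − ∫∏x_i^{j_i} dQ| ≤ 2^{−n}` for EVERY exponent vector (the moments agree unless some `j_i ≥ n`, and then both products are
`≤ 2^{−n}` — NO `d` in the closeness), while the additive test function `Σ_i (1 − cos 2πnx_i)∕(2πn)` (`1`-Lipschitz for `Σ_i|u_i − v_i|`, values in
`[0, d∕(πn)]`) is paid EXACTLY `d∕(πn)`. [folklore] -/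
theorem exists_uniformMixedMoments_close_laws_far (ι : Type*) [Fintype ι] [Nonempty ι] {n : ℕ} (hn : 0 < n) :
    ∃ P Q : Measure (ι → ℝ), IsProbabilityMeasure P ∧ IsProbabilityMeasure Q ∧
      P (Set.pi Set.univ (fun _ : ι => Set.Icc (0 : ℝ) 1))ᶜ = 0 ∧ Q (Set.pi Set.univ (fun _ : ι => Set.Icc (0 : ℝ) 1))ᶜ = 0 ∧
      (∀ j : ι → ℕ, |∫ x, ∏ i, x i ^ j i ∂P - ∫ x, ∏ i, x i ^ j i ∂Q| ≤ (1 / 2 : ℝ) ^ n) ∧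
      |∫ x, ∑ i, (1 - cos (π * (2 * n : ℕ) * x i)) / (π * (2 * n : ℕ)) ∂P -
          ∫ x, ∑ i, (1 - cos (π * (2 * n : ℕ) * x i)) / (π * (2 * n : ℕ)) ∂Q| = Fintype.card ι / (π * n) := by
  classical
  obtain ⟨μ, ν, iμ, iν, hμ, hν, hmomμ, hmomν, hagree, htest⟩ := exists_halfInterval_witness hn
  have hnr : (0 : ℝ) < n := Nat.cast_pos.2 hn
  -- `P = ν^{⊗ι}`, `Q = μ^{⊗ι}` (orientation: the payment is `d·(−(−1)^n∕(πn))`, absolute value `d∕(πn)`)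
  refine ⟨Measure.pi fun _ : ι => ν, Measure.pi fun _ : ι => μ, inferInstance, inferInstance, ?_, ?_, fun j => ?_, ?_⟩
  · -- carried by `[0,1]^ι`
    have hIcc : ν (Set.Icc (0 : ℝ) 1) = 1 := by
      rw [← prob_compl_eq_zero_iff measurableSet_Icc]
      exact measure_mono_null (Set.compl_subset_compl.2 (Set.Icc_subset_Icc_right (by norm_num))) hν
    rw [prob_compl_eq_zero_iff (MeasurableSet.univ_pi fun _ => measurableSet_Icc), Measure.pi_pi]
    simp [hIcc]
  · have hIcc : μ (Set.Icc (0 : ℝ) 1) = 1 := by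
      rw [← prob_compl_eq_zero_iff measurableSet_Icc]
      exact measure_mono_null (Set.compl_subset_compl.2 (Set.Icc_subset_Icc_right (by norm_num))) hμ
    rw [prob_compl_eq_zero_iff (MeasurableSet.univ_pi fun _ => measurableSet_Icc), Measure.pi_pi]
    simp [hIcc]
  · -- mixed moments: products of moments; split along `S = {i : n ≤ j_i}`
    rw [integral_fintype_prod_eq_prod (fun i (y : ℝ) => y ^ j i), integral_fintype_prod_eq_prod (fun i (y : ℝ) => y ^ j i)]
    by_cases hS : (Finset.univ.filter fun i => n ≤ j i).Nonempty
    · refine (abs_prod_sub_prod_le_of_agree (fun i => n ≤ j i) (fun i hi => hagree (j i) (not_le.1 hi)) (fun i => (hmomν (j i)).1)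
        (fun i => (hmomν (j i)).2.trans (pow_le_one₀ (by norm_num) (by norm_num))) (fun i => (hmomμ (j i)).1)).trans ?_
      exact max_le (prod_le_half_pow_of_le hS (fun i => (hmomν (j i)).1) (fun i => (hmomν (j i)).2) fun i hi => (Finset.mem_filter.1 hi).2)
        (prod_le_half_pow_of_le hS (fun i => (hmomμ (j i)).1) (fun i => (hmomμ (j i)).2) fun i hi => (Finset.mem_filter.1 hi).2)
    · -- all `j_i < n`: the moments agree
      have hall : ∀ i, j i < n := fun i => by
        by_contra h
        exact hS ⟨i, Finset.mem_filter.2 ⟨Finset.mem_univ _, not_lt.1 h⟩⟩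
      rw [Finset.prod_congr rfl fun i _ => hagree (j i) (hall i), sub_self, abs_zero]
      positivity
  · -- the additive test function: `Σ_i (∫cw dν − ∫cw dμ) = d·(−(−1)^n∕(πn))`
    set cw : ℝ → ℝ := fun y => (1 - cos (π * (2 * n : ℕ) * y)) / (π * (2 * n : ℕ)) with hcw
    have hcwc : Continuous cw := ((continuous_const.sub (Real.continuous_cos.comp (continuous_const.mul continuous_id))).div_const _)
    have hcoord : ∀ (κ : Measure ℝ) [IsProbabilityMeasure κ] (i : ι),
        ∫ x : ι → ℝ, cw (x i) ∂(Measure.pi fun _ : ι => κ) = ∫ y, cw y ∂κ := by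
      intro κ _ i
      have hmp := measurePreserving_eval (μ := fun _ : ι => κ) i
      calc ∫ x : ι → ℝ, cw (x i) ∂(Measure.pi fun _ : ι => κ)
          = ∫ y, cw y ∂(Measure.map (Function.eval i) (Measure.pi fun _ : ι => κ)) :=
            (integral_map hmp.measurable.aemeasurable hcwc.aestronglyMeasurable).symm
        _ = ∫ y, cw y ∂κ := by rw [hmp.map_eq]
    have hint : ∀ (κ : Measure ℝ) [IsProbabilityMeasure κ],
        ∫ x : ι → ℝ, ∑ i, cw (x i) ∂(Measure.pi fun _ : ι => κ) = Fintype.card ι * ∫ y, cw y ∂κ := by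
      intro κ _
      rw [integral_finsetSum _ fun i _ => ?_]
      · simp_rw [hcoord κ]
        rw [Finset.sum_const, nsmul_eq_mul, Finset.card_univ]
      · exact (integrable_const (2 / (π * (2 * n : ℕ)))).mono' ((hcwc.comp (continuous_apply i)).aestronglyMeasurable)
          (Filter.Eventually.of_forall fun x => by
            rw [Real.norm_eq_abs, abs_of_nonneg (cosWave_nonneg _ _)]
            exact cosWave_le _ _)
    show |∫ x : ι → ℝ, ∑ i, cw (x i) ∂(Measure.pi fun _ : ι => ν) - ∫ x : ι → ℝ, ∑ i, cw (x i) ∂(Measure.pi fun _ : ι => μ)| = _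
    rw [hint ν, hint μ, ← mul_sub, show ∫ y, cw y ∂ν - ∫ y, cw y ∂μ = -(-1 : ℝ) ^ n * (1 / (π * n)) from htest, abs_mul,
      abs_of_nonneg (Nat.cast_nonneg _), abs_mul, abs_neg, abs_pow, abs_neg, abs_one, one_pow, one_mul,
      abs_of_pos (by positivity : (0 : ℝ) < 1 / (π * n))]
    ring

/-! ## §4 ★★ TWO-SIDED: additive `Θ(d∕log r⁻¹)`, general ℓ¹-Lipschitz between `d` and `d²` -/

/-- **★★ THE DIMENSION DEPENDENCE OF THE UNIFORM-MIXED-MOMENT PRICE** [folklore].  For a finite nonempty family `ι` (`d = |ι|`):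
(i) GENERAL UPPER: laws `P, Q` on `[−1,1]^ι` with all mixed moments within `0 < r ≤ 1`, `f` continuous with `|f u − f v| ≤ KΣ|u_i − v_i|`, `|f| ≤ G`
on the cube: `|∫f dP − ∫f dQ| ≤ (76Kd² + 12Gd)∕(1 + log r⁻¹)`;
(ii) ADDITIVE UPPER: for `f = Σ_i g_i(x_i)`, `g_i` `K`-Lipschitz and `G`-bounded on `[−1,1]`: `≤ 48d(K+G)∕(1 + log r⁻¹)`;
(iii) LOWER: for every `0 < r₀ ≤ 1` there are laws `P, Q` on `[0,1]^ι`, `0 < r ≤ r₀` with all mixed moments within `r`, and `1`-Lipschitz `g : ℝ → [0,1]`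
such that the ADDITIVE `f = Σ_i g(x_i)` is paid `|∫f dP − ∫f dQ| ≥ (d∕6)∕(1 + log r⁻¹)` (§3 at `r = 2^{−n} ≤ r₀`: `d∕(πn) ≥ (d∕6)∕(1 + n log 2)`).
So the additive class is `Θ(d∕(1 + log r⁻¹))` TWO-SIDED; the general class lies between `d` and `d²` (gap not closed here). -/
theorem jointLaw_price_dimension_two_sided (ι : Type*) [Fintype ι] [Nonempty ι] :
    (∀ (P Q : Measure (ι → ℝ)) [IsProbabilityMeasure P] [IsProbabilityMeasure Q],
      P (Set.pi Set.univ (fun _ : ι => Set.Icc (-1 : ℝ) 1))ᶜ = 0 → Q (Set.pi Set.univ (fun _ : ι => Set.Icc (-1 : ℝ) 1))ᶜ = 0 →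
      ∀ r : ℝ, 0 < r → r ≤ 1 → (∀ j : ι → ℕ, |∫ x, ∏ i, x i ^ j i ∂P - ∫ x, ∏ i, x i ^ j i ∂Q| ≤ r) →
      ∀ f : (ι → ℝ) → ℝ, Continuous f → ∀ K G : ℝ, 0 ≤ K →
        (∀ u v : ι → ℝ, (∀ i, u i ∈ Set.Icc (-1 : ℝ) 1) → (∀ i, v i ∈ Set.Icc (-1 : ℝ) 1) → |f u - f v| ≤ K * ∑ i, |u i - v i|) →
        (∀ u : ι → ℝ, (∀ i, u i ∈ Set.Icc (-1 : ℝ) 1) → |f u| ≤ G) →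
        |∫ x, f x ∂P - ∫ x, f x ∂Q| ≤ (76 * K * (Fintype.card ι : ℝ) ^ 2 + 12 * G * Fintype.card ι) / (1 + Real.log r⁻¹)) ∧
    (∀ (P Q : Measure (ι → ℝ)) [IsProbabilityMeasure P] [IsProbabilityMeasure Q],
      P (Set.pi Set.univ (fun _ : ι => Set.Icc (-1 : ℝ) 1))ᶜ = 0 → Q (Set.pi Set.univ (fun _ : ι => Set.Icc (-1 : ℝ) 1))ᶜ = 0 →
      ∀ r : ℝ, 0 < r → r ≤ 1 → (∀ j : ι → ℕ, |∫ x, ∏ i, x i ^ j i ∂P - ∫ x, ∏ i, x i ^ j i ∂Q| ≤ r) →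
      ∀ g : ι → ℝ → ℝ, (∀ i, Continuous (g i)) → ∀ K G : ℝ, 0 ≤ K →
        (∀ (i : ι) (x y : ℝ), x ∈ Set.Icc (-1 : ℝ) 1 → y ∈ Set.Icc (-1 : ℝ) 1 → |g i x - g i y| ≤ K * |x - y|) →
        (∀ (i : ι) (x : ℝ), x ∈ Set.Icc (-1 : ℝ) 1 → |g i x| ≤ G) →
        |∫ x, ∑ i, g i (x i) ∂P - ∫ x, ∑ i, g i (x i) ∂Q| ≤ 48 * Fintype.card ι * (K + G) / (1 + Real.log r⁻¹)) ∧
    (∀ r₀ : ℝ, 0 < r₀ → r₀ ≤ 1 → ∃ P Q : Measure (ι → ℝ), IsProbabilityMeasure P ∧ IsProbabilityMeasure Q ∧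
      P (Set.pi Set.univ (fun _ : ι => Set.Icc (0 : ℝ) 1))ᶜ = 0 ∧ Q (Set.pi Set.univ (fun _ : ι => Set.Icc (0 : ℝ) 1))ᶜ = 0 ∧
      ∃ r : ℝ, 0 < r ∧ r ≤ r₀ ∧ (∀ j : ι → ℕ, |∫ x, ∏ i, x i ^ j i ∂P - ∫ x, ∏ i, x i ^ j i ∂Q| ≤ r) ∧
        ∃ g : ℝ → ℝ, LipschitzWith 1 g ∧ (∀ x, 0 ≤ g x ∧ g x ≤ 1) ∧
          (Fintype.card ι : ℝ) / 6 / (1 + Real.log r⁻¹) ≤ |∫ x, ∑ i, g (x i) ∂P - ∫ x, ∑ i, g (x i) ∂Q|) := by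
  refine ⟨fun P Q _ _ hP hQ r hr0 hr1 hmom f hf K G hK0 hK hG => law_price_le_of_uniformMixedMoments hP hQ hr0 hr1 hmom hf hK0 hK hG,
    fun P Q _ _ hP hQ r hr0 hr1 hmom g hg K G hK0 hK hG => law_price_additive_le_card hP hQ hr0 hr1 hmom hg hK0 hK hG,
    fun r₀ hr₀ hr₀1 => ?_⟩
  -- choose `n ≥ 1` with `2^{−n} ≤ r₀`
  obtain ⟨n₀, hn₀⟩ := exists_pow_lt_of_lt_one hr₀ (by norm_num : (1 / 2 : ℝ) < 1)
  set n : ℕ := n₀ + 1 with hndef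
  have hn : 0 < n := Nat.succ_pos _
  have hnr : (0 : ℝ) < n := Nat.cast_pos.2 hn
  have hrn : (1 / 2 : ℝ) ^ n ≤ r₀ := (pow_le_pow_of_le_one (by norm_num) (by norm_num) (Nat.le_succ _)).trans hn₀.le
  obtain ⟨P, Q, iP, iQ, hP, hQ, hmom, htest⟩ := exists_uniformMixedMoments_close_laws_far ι hn
  set d : ℕ := Fintype.card ι
  refine ⟨P, Q, iP, iQ, hP, hQ, (1 / 2 : ℝ) ^ n, by positivity, hrn, hmom,
    fun x => (1 - cos (π * (2 * n : ℕ) * x)) / (π * (2 * n : ℕ)), lipschitzWith_one_cosWave (by omega), fun x => ⟨cosWave_nonneg _ _, ?_⟩, ?_⟩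
  · refine (cosWave_le _ _).trans ?_
    have h2n : (1 : ℝ) ≤ (2 * n : ℕ) := by exact_mod_cast (by omega : 1 ≤ 2 * n)
    rw [div_le_one (by positivity)]
    nlinarith [Real.pi_gt_three]
  · rw [htest]
    have hL : Real.log ((1 / 2 : ℝ) ^ n)⁻¹ = n * Real.log 2 := by
      rw [Real.log_inv, Real.log_pow, one_div, Real.log_inv]; ring
    have hd1 : (1 : ℝ) ≤ d := by exact_mod_cast (Fintype.card_pos : 0 < d)
    rw [hL, div_div, div_le_div_iff₀ (by positivity) (by positivity)]
    have hl2 := Real.log_two_gt_d9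
    have hπ := Real.pi_le_four
    have hn1 : (1 : ℝ) ≤ n := by exact_mod_cast hn
    -- `d·(π n) ≤ 6(1 + n log 2)·d`
    nlinarith [mul_le_mul_of_nonneg_right hπ hnr.le, Real.pi_pos, mul_nonneg (sub_nonneg.2 hd1) hnr.le,
      mul_le_mul_of_nonneg_left (show π * n ≤ 6 * (1 + n * Real.log 2) by nlinarith) (by positivity : (0 : ℝ) ≤ d)]

end Summit.QuantumFields.YangMills.Theorems.BalabanUVNodesN19JointLawPriceDimensionWitness

end
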